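import Literature.Computation.AbelianHilbFock.WindowCertificate10
import HarnessLib

/-!
# Window-closure certificate for ALL `n ≥ 10`: `H^{≤8}(A^[n])` lies in the `(∪H^{≤3}, f_α)`-closure of `1`
# (COMPUTATIONAL, `native_decide`; cell `hodge-kum4`, lane (V), seat `hodge-kum4-veng`)

EVIDENCE (numbers, kernel-evaluated), extending `WindowCertificate10` from `n = 10` to every `n ≥ 10` with the
SAME 8 069 words (`words10d8`).  The argument, all of whose computational steps are executed here:

1. **Stable coordinates.**  For `n ≥ 10` the classes `B_λ(n) = q_λ · q₁(1)^{n−|λ|}/(n−|λ|)! |0⟩`, `λ` a monomial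
   WITHOUT the letter `q₁(1)` and of cohomological degree `≤ 10` (then `|λ| ≤ 10 ≤ n`), form a basis of
   `H^{≤10}(A^[n])`; the index set (`CtxS.red`, the 29 932 reduced window monomials) does not depend on `n`.
2. **Operators are affine in `n`.**  A normally ordered term of a lane operator that annihilates `j` letters `q₁(1)`
   and creates `s` of them sends `B_λ(n)` to `c · [k − j + s]_s · B_λ'(n)`, `k = n − |λ|` (falling factorial), an
   identity valid whenever `|λ'| ≤ n`; here `s ≤ 1` always (`s = 1` only for `𝔊₁(1)` on `q_{b+1}(1)` and for `f_α`
   on `q₁(e₀₁)`, `q₁(e₂₃)`).  `Op.applyS` implements exactly this bookkeeping with coefficients in `F_p[n]`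
   (`p = 2³¹ − 1`): so the stable coordinates of every word are POLYNOMIALS in `n`, computed here symbolically
   (`CtxS.replayS`); the third component of `certAllN10d8` re-checks that their values at `n = 10` (times `10!`) are the
   stable coordinates of the numerically replayed words of `WindowCertificate10` (same engine, `Ctx.replay`).
3. **Hermite form.**  In each (degree `d ≤ 8`, torus weight) block the `F_p[n]`-module spanned by the word columns
   is computed: constant columns first (row reduction mod `p`), then unimodular column operations (polynomial
   Euclid, `hermiteAllUnits`) on the residual polynomial columns.  `allN10_d8` records that in EVERY block every
   diagonal invariant factor is a UNIT, i.e. the module is all of `F_p[n]^{b}`.  Hence for every integer `n₀ ≥ 10`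
   the word vectors evaluated at `n₀` span `F_p^{b_d}` modulo `p`, so (denominators being prime to `p`) their
   `ℚ`-span is `H^d(A^[n₀];ℚ)` for every `d ≤ 8`:

   **for all `n ≥ 10`: `H^{≤8}(A^[n];ℚ)` ⊆ the (cup product by `H^{≤3}`, `f_α`)-closure of `1` inside `H^{≤10}`.**

   (For `n ≤ 9` the cell's kit runs give the same directly: full closures at `n = 2,…,6`, the fixed words full at
   `n = 8, 9` — `pub/hodge-kum4/veng/REPORT-veng.md`; the kernel statement here is the `n ≥ 10` part.)

What is NOT certified here (as in `WindowCertificate10`): the identification of the computable operators with the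
geometric ones (Li–Qin–Wang IMRN 2002 Thm 4.6 with `K = 0 = e`; the `f_α` of BRIEF-LANE-V §2), cited and
numerically validated; degrees `9, 10`; anything about the full statement `L1-Hilb(n)`.
Nothing here asserts L1 / L1-Hilb(n) / V0 / MODEL_X / HC_Kum4Type / HC.

Sources: Li–Qin–Wang, IMRN 2002, Thm 4.6; Li–Qin–Wang, J. reine angew. Math. 554 (2003) (stability of the cup
product in the basis `1_{-(n-Σ)} ∏ 𝔞_{-m}(γ)|0⟩` — the stable coordinates used here); Oberdieck, CMH 96 (2021) §3.2.
-/

set_option autoImplicit false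

namespace Literature.Computation.AbelianHilbFock

/-! ## Polynomials over `F_p` (dense coefficient arrays, low degree first, trimmed) -/

/-- A polynomial over `F_p` as its coefficient array (trailing zeros removed; `#[]` is zero). [folklore] -/
abbrev PolyP := Array Nat

namespace PolyP

/-- Remove trailing zero coefficients. [folklore] -/
def trim (a : PolyP) : PolyP := Id.run do
  let mut b := a
  while b.size > 0 && b.back! == 0 do b := b.pop
  return b

/-- Is the zero polynomial. [folklore] -/
def isZero (a : PolyP) : Bool := (trim a).size == 0

/-- Degree (`0` for the zero polynomial as well; use `isZero` to distinguish). [folklore] -/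
def deg (a : PolyP) : Nat := (trim a).size - 1

/-- Sum. [folklore] -/
def add (a b : PolyP) : PolyP :=
  trim ((Array.range (max a.size b.size)).map fun i ↦ (a.getD i 0 + b.getD i 0) % PRIME)

/-- Scalar multiple. [folklore] -/
def smul (s : Nat) (a : PolyP) : PolyP := trim (a.map fun x ↦ x * s % PRIME)

/-- Product. [folklore] -/
def mul (a b : PolyP) : PolyP := Id.run do
  if a.size == 0 || b.size == 0 then return #[]
  let mut r : Array Nat := Array.replicate (a.size + b.size - 1) 0
  for i in [0:a.size] do
    let ai := a[i]!
    if ai != 0 then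
      for j in [0:b.size] do
        r := r.set! (i + j) ((r[i + j]! + ai * b[j]!) % PRIME)
  return trim r

/-- `a − q·b`. [folklore] -/
def subMul (a q b : PolyP) : PolyP := add a (smul (PRIME - 1) (mul q b))

/-- Quotient of the Euclidean division `a = q b + r` (`b ≠ 0`). [folklore] -/
def quo (a b : PolyP) : PolyP := Id.run do
  let b := trim b
  let mut r := trim a
  if b.size == 0 then return #[]
  let ib := invMod b.back!
  let mut q : Array Nat := Array.replicate (if r.size ≥ b.size then r.size - b.size + 1 else 1) 0
  while r.size ≥ b.size && r.size > 0 do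
    let s := r.back! * ib % PRIME
    let sh := r.size - b.size
    q := q.set! sh ((q[sh]! + s) % PRIME)
    let mut r2 := r
    for i in [0:b.size] do
      r2 := r2.set! (i + sh) ((r2[i + sh]! + PRIME * PRIME - s * b[i]!) % PRIME)
    r := trim r2
  return trim q

/-- Value at a point. [folklore] -/
def eval (a : PolyP) (x : Nat) : Nat := a.foldr (fun c r ↦ (r * x + c) % PRIME) 0

/-- The constant polynomial. [folklore] -/
def const (c : Nat) : PolyP := trim #[c % PRIME]

end PolyP

/-! ## Symbolic (stable-coordinate) operator action -/

/-- A symbolic state term: coefficient in `F_p[n]`, block-count offset `koff` (the monomial carries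
`q₁(1)^{κ}/κ!` with `κ = n − m₀ + koff`, `m₀` = points of the reduced monomial the operator was applied to), and
the reduced monomial (no letter `q₁(1)`). [folklore] -/
abbrev STerm := PolyP × Int × Mono

/-- One elementary operator on symbolic terms: the creator `q₁(1)` multiplies by `κ + 1 = n − m₀ + koff + 1`; the
annihilator `𝔞₁(pt)` removes one block letter with coefficient `−1` (n-free: `κ · q₁(1)^{κ−1}/κ! = q₁(1)^{κ−1}/(κ−1)!`);
all other letters are handled by `insertLetter` / `annihilate` on the reduced monomial (block letters are even and
stand in front, so no extra signs). [cite: LiQinWang2002W, Thm 3.1(i) (Heisenberg relations, sign convention)] -/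
def applyElemS (i : Int) (J : Nat) (m0 : Nat) (v : List STerm) : List STerm :=
  if i < 0 then
    let lt := 16 * (-i).toNat + J
    if lt == 16 then
      v.map fun (c, koff, mono) ↦
        (PolyP.mul c (PolyP.trim #[(((koff + 1 - (m0 : Int)) % (PRIME : Int) + PRIME) % PRIME).toNat, 1]), koff + 1, mono)
    else
      v.filterMap fun (c, koff, mono) ↦ match insertLetter lt mono with
        | none => none
        | some (s, nm) => some (if s == 1 then c else PolyP.smul (PRIME - 1) c, koff, nm)
  else
    let m := i.toNat
    if m == 1 && J == 15 then
      -- 𝔞₁(pt): kills a block letter q₁(1); g(pt, 1) = 1, coefficient −1 per hit, normalised: −1 total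
      v.map fun (c, koff, mono) ↦ (PolyP.smul (PRIME - 1) c, koff - 1, mono)
    else
      v.flatMap fun (c, koff, mono) ↦ (annihilate m J mono).map fun (d, nm) ↦
        (PolyP.smul ((((d % (PRIME : Int)) + PRIME) % PRIME).toNat) c, koff, nm)

/-- Apply a lane operator to the stable basis vector `B_λ` (`λ` reduced): list of symbolic terms
`(c(n), koff, λ')` meaning `c(n) · B_{λ'}(n)`. [cite: LiQinWang2002W, Thm 4.6 (𝔊_k for K, e numerically trivial)] -/
def Op.applyS (op : Op) (lam : Mono) : List STerm :=
  let m0 := mPts lam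
  if op.isDeriv then Id.run do
    let arr := lam.toArray
    let mut out : List STerm := []
    let mut noddBefore := 0
    -- (a) the derivation hits one of the κ block letters q₁(1): n-free unless the image is q₁(1) itself
    for (Q, c) in op.derivTable.getD 0 [] do
      let fac : Nat := (((c % (PRIME : Int)) + PRIME) % PRIME).toNat      -- m^s = 1 for m = 1
      if Q == 0 then
        -- κ · c · B_λ : polynomial factor κ = n − m₀ + koff (koff = 0 here)
        out := (PolyP.smul fac (PolyP.trim #[(PRIME - m0 % PRIME) % PRIME, 1]), 0, lam) :: out
      else
        match insertLetter (16 + Q) lam with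
        | none => pure ()
        | some (s2, nm) => out := (PolyP.const (if s2 == 1 then fac else (PRIME - fac) % PRIME), -1, nm) :: out
    -- (b) the derivation hits a letter of λ (exactly as `Op.apply`, coefficients reduced mod p)
    for idx in [0:arr.size] do
      let l := arr[idx]!
      let m := l / 16
      let P := l % 16
      let tab := op.derivTable.getD P []
      if !tab.isEmpty then
        let rest : Mono := (arr.extract 0 idx).toList ++ (arr.extract (idx + 1) arr.size).toList
        let s0 : Int := if op.par == 1 && noddBefore % 2 == 1 then -1 else 1
        for (Q, c) in tab do
          let facQ : ℚ := if op.derivPow == 1 then (m : ℚ) else if op.derivPow == -1 then (1 : ℚ) / (m : ℚ) else 1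
          if 16 * m + Q == 16 then
            -- creates a block letter: factor (κ + 1) = n − m₀ + 1 (koff 0 → 1)
            let cc : ℚ := ((s0 * c : Int) : ℚ) * facQ
            out := (PolyP.smul (ratModP cc) (PolyP.trim #[(PRIME + 1 - m0 % PRIME) % PRIME, 1]), 1, rest) :: out
          else
            match insertLetter (16 * m + Q) rest with
            | none => pure ()
            | some (s2, nm) =>
              let s1 : Int := if lPar Q == 1 && noddBefore % 2 == 1 then -1 else 1
              let cc : ℚ := ((s0 * s1 * s2 * c : Int) : ℚ) * facQ
              out := (PolyP.const (ratModP cc), 0, nm) :: out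
      noddBefore := noddBefore + lPar l
    return out
  else Id.run do
    -- normally ordered chains: the letters present are those of λ plus (symbolically) the block letter 16
    let ds := (16 :: lam).eraseDups
    let mut out : List STerm := []
    let run (chs : Array Chain) (out : List STerm) : List STerm :=
      chs.foldl (fun o ch ↦
        let init : List STerm := [(PolyP.const ((((ch.coeff % (PRIME : Int)) + PRIME) % PRIME).toNat), 0, lam)]
        let res := ch.ops.foldl (fun v p ↦ applyElemS p.1 p.2 m0 v) init
        let dinv := invMod op.den
        res.foldl (fun o2 r ↦ (PolyP.smul dinv r.1, r.2.1, r.2.2) :: o2) o) out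
    for L1 in ds do
      match op.byAnn1.get? L1 with
      | some chs => out := run chs out
      | none => pure ()
      for L2 in ds do
        match op.byAnn2.get? (256 * L1 + L2) with
        | some chs => out := run chs out
        | none => pure ()
    return out

/-! ## The symbolic context: reduced basis, symbolic columns, symbolic replay -/

/-- Strip the block letters `q₁(1)` (letter `16`, the smallest, hence a prefix) from a window monomial. [folklore] -/
def reduceMono (mono : Mono) : Mono := mono.filter fun l ↦ l != 16

/-- Symbolic context over the window basis of `Ctx.build 10 10`: reduced monomials and their index (the stable basis
of Li–Qin–Wang). [cite: GolubVanLoan2013, §1.1.8 (column-oriented gaxpy: Ax as a linear combination of columns)] -/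
structure CtxS where
  C : Ctx
  red : Array Mono
  rindex : Std.HashMap Mono Nat

/-- Build the symbolic context from the numeric one (same index set: window monomial `i` ↦ its reduced monomial). [folklore] -/
def CtxS.build (C : Ctx) : CtxS := Id.run do
  let red := C.B.map reduceMono
  let mut rindex : Std.HashMap Mono Nat := Std.HashMap.emptyWithCapacity (2 * red.size + 1)
  for i in [0:red.size] do rindex := rindex.insert red[i]! i
  return { C := C, red := red, rindex := rindex }

/-- A symbolic sparse vector: basis index ↦ polynomial in `n` over `F_p`. [folklore] -/
abbrev VecS := Std.HashMap Nat PolyP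

/-- Add `c(n) · e_t` into a symbolic vector. [folklore] -/
def VecS.addAt (w : VecS) (t : Nat) (c : PolyP) : VecS :=
  let x := PolyP.add (w.getD t #[]) c
  if x.size == 0 then w.erase t else w.insert t x

/-- Symbolic column of operator `j` at reduced basis index `i`: list of (target index, polynomial), images outside
the window dropped; the flag is `false` if some image of degree `≤ 10` were missing from the index (never). [cite: GolubVanLoan2013, §1.1.8 (column-oriented gaxpy: Ax as a linear combination of columns)] -/
def CtxS.colS (S : CtxS) (j i : Nat) : Array (Nat × PolyP) × Bool := Id.run do
  let terms := (S.C.ops.getD j hOp).applyS (S.red.getD i [])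
  let mut acc : VecS := Std.HashMap.emptyWithCapacity 32
  let mut ok := true
  for (c, _, lam) in terms do
    match S.rindex.get? lam with
    | some t => acc := acc.addAt t c
    | none => if mDeg lam ≤ S.C.dmax then ok := false
  return (acc.fold (fun (a : Array (Nat × PolyP)) t c ↦ a.push (t, c)) #[], ok)

/-- Symbolic replay of a word list (word `0` = `B_∅ = 1`), columns memoised; returns the polynomial word vectors
and the conjunction of the flags. [cite: GolubVanLoan2013, §1.1.8 (column-oriented gaxpy: Ax as a linear combination of columns)] -/
def CtxS.replayS (S : CtxS) (words : Array (Nat × Nat)) : Array VecS × Bool := Id.run do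
  let seed : VecS := (Std.HashMap.emptyWithCapacity 2).insert (S.rindex.getD [] 0) (PolyP.const 1)
  let mut W : Array VecS := #[seed]
  let mut cache : Std.HashMap Nat (Array (Nat × PolyP)) := Std.HashMap.emptyWithCapacity 65536
  let mut ok := true
  for k in [1:words.size] do
    let (j, par) := words[k]!
    let w := (W.getD par seed).toArray
    let mut acc : VecS := Std.HashMap.emptyWithCapacity 64
    for (i, c) in w do
      let key := j * 4294967296 + i
      let col ← match cache.get? key with
        | some col => pure col
        | none => do
          let (col, okc) := S.colS j i
          cache := cache.insert key col
          if !okc then ok := false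
          pure col
      for (t, e) in col do
        acc := acc.addAt t (PolyP.mul c e)
    W := W.push acc
  return (W, ok)

/-! ## Hermite elimination over `F_p[n]` per block -/

/-- Row reduction modulo `p` of CONSTANT columns (as dense rows of a block of size `m`); returns the RREF rows
with their pivots. [folklore] -/
def rrefConst (rows : Array (Array Nat)) (m : Nat) : Array (Nat × Array Nat) := Id.run do
  let mut piv : Array (Nat × Array Nat) := #[]
  for r0 in rows do
    let mut r := r0
    for (pc, prow) in piv do
      let c := r[pc]!
      if c != 0 then
        r := (Array.range m).map fun t ↦ (r[t]! + PRIME * PRIME - c * prow[t]!) % PRIME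
    match (Array.range m).find? (fun t ↦ r[t]! != 0) with
    | none => pure ()
    | some pc =>
      let iv := invMod r[pc]!
      let nr := r.map fun x ↦ x * iv % PRIME
      -- keep earlier rows reduced at the new pivot column
      piv := piv.map fun (qc, qrow) ↦
        let c := qrow[pc]!
        if c == 0 then (qc, qrow) else (qc, (Array.range m).map fun t ↦ (qrow[t]! + PRIME * PRIME - c * nr[t]!) % PRIME)
      piv := piv.push (pc, nr)
  return piv

/-- Hermite-type elimination of polynomial columns (each an array of `q` polynomials) by unimodular column
operations, rows top-down: returns `true` iff every row receives a pivot that is a non-zero CONSTANT (a unit of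
`F_p[n]`), i.e. the column module is all of `F_p[n]^q`. [folklore] -/
def hermiteAllUnits (cols0 : Array (Array PolyP)) (q : Nat) : Bool := Id.run do
  let mut cols := cols0
  let mut active : Array Nat := Array.range cols.size
  let mut good := true
  for row in [0:q] do
    let mut piv : Option Nat := none
    for ci in active do
      if !(PolyP.isZero (cols[ci]!)[row]!) then
        match piv with
        | none => piv := some ci
        | some pv =>
          let mut x := pv
          let mut y := ci
          let mut guard := 0
          while !(PolyP.isZero (cols[y]!)[row]!) && guard < 100000 do
            guard := guard + 1
            if PolyP.deg (cols[x]!)[row]! ≥ PolyP.deg (cols[y]!)[row]! then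
              let qt := PolyP.quo (cols[x]!)[row]! (cols[y]!)[row]!
              let cx := cols[x]!
              let cy := cols[y]!
              cols := cols.set! x ((Array.range q).map fun t ↦ PolyP.subMul (cx.getD t #[]) qt (cy.getD t #[]))
            let tmp := x
            x := y
            y := tmp
          piv := some x
    match piv with
    | none => good := false
    | some pv =>
      let g := (cols[pv]!)[row]!
      if PolyP.isZero g || PolyP.deg g != 0 then good := false
      active := active.filter fun ci ↦ ci != pv
  return good

/-- For one block (size `m`, local coordinates of its indices given by `C.locOf`): split the word vectors lying
in the block into constant and polynomial columns, reduce, and decide whether the `F_p[n]`-module they span is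
everything.  Returns (number of constant columns, rank of the constant columns, residual dimension, verdict). [folklore] -/
def blockVerdict (C : Ctx) (m : Nat) (vecs : Array VecS) : Nat × Nat × Nat × Bool := Id.run do
  let mut constRows : Array (Array Nat) := #[]
  let mut polyCols : Array (Array PolyP) := #[]
  for w in vecs do
    let isConst := w.fold (fun ok _ c ↦ ok && (PolyP.trim c).size ≤ 1) true
    if isConst then
      constRows := constRows.push (w.fold (fun (r : Array Nat) i c ↦ r.set! (C.locOf.getD i 0) ((PolyP.trim c).getD 0 0)) (Array.replicate m 0))
    else
      polyCols := polyCols.push (w.fold (fun (r : Array PolyP) i c ↦ r.set! (C.locOf.getD i 0) (PolyP.trim c)) (Array.replicate m #[]))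
  let piv := rrefConst constRows m
  let r0 := piv.size
  let q := m - r0
  if q == 0 then return (constRows.size, r0, 0, true)
  let pivCols : Array Nat := piv.map (·.1)
  let nonpiv : Array Nat := (Array.range m).filter fun t ↦ !pivCols.contains t
  -- project the polynomial columns: kill the pivot rows using the constant RREF rows (polynomial multiples)
  let mut proj : Array (Array PolyP) := #[]
  for col0 in polyCols do
    let mut col := col0
    for (pc, prow) in piv do
      let c := col[pc]!
      if !(PolyP.isZero c) then
        col := (Array.range m).map fun t ↦ if t == pc then #[] else PolyP.subMul (col[t]!) c (PolyP.const (prow[t]!))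
    let v := nonpiv.map fun t ↦ col[t]!
    if v.any fun x ↦ !(PolyP.isZero x) then proj := proj.push v
  return (constRows.size, r0, q, hermiteAllUnits proj q)

/-- The symbolic context at `n ≥ 10`, window `10` (reduced basis of `ctx10`). [folklore] -/
def ctxS10 : CtxS := CtxS.build ctx10

/-- The ALL-`n` certificate datum for degrees `≤ 8`: (number of words, column flag, the numeric cross-check flag:
the polynomial word vectors evaluated at `n = 10`, times `10!` (the numeric seed is `q₁(1)¹⁰|0⟩ = 10!·B_∅`), coincide
with the stable coordinates (prefix stripped, times `k!`) of the numerically replayed words of `WindowCertificate10`,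
and for each degree `d = 0…8`: (dimension `b_d`,
number of blocks, number of blocks whose `F_p[n]`-module of word columns is everything)). [folklore] -/
def certAllN10d8 : Nat × Bool × Bool × List (Nat × Nat × Nat) := Id.run do
  let S := ctxS10
  let C := S.C
  let (WS, ok) := S.replayS words10d8
  -- numeric cross-check at n = 10
  let (WN, _) := C.replay words10d8
  let fact : Array Nat := Id.run do
    let mut f : Array Nat := #[1]
    for k in [1:11] do f := f.push (f[k - 1]! * k % PRIME)
    return f
  let mut same := WS.size == WN.size
  for k in [0:WS.size] do
    let ws := WS[k]!
    let wn := WN.getD k (Std.HashMap.emptyWithCapacity 1)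
    -- numeric word: index i (window monomial with kk block letters) ↦ value; stable coordinate = value * kk!
    let wnS : Std.HashMap Nat Nat := wn.fold (fun (acc : Std.HashMap Nat Nat) i x ↦
      let kk := (C.B.getD i []).length - (S.red.getD i []).length
      acc.insert i (x * fact.getD kk 0 % PRIME)) (Std.HashMap.emptyWithCapacity 64)
    let eq1 := ws.fold (fun okk i c ↦ okk && PolyP.eval c 10 * fact.getD 10 0 % PRIME == wnS.getD i 0) true
    let eq2 := wnS.fold (fun okk i x ↦ okk && (x == 0 || ws.contains i)) true
    if !(eq1 && eq2) then same := false
  -- blocks of degree <= 8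
  let mut byBlock : Std.HashMap Nat (Array VecS) := Std.HashMap.emptyWithCapacity 512
  for w in WS do
    if !w.isEmpty then
      let someIdx := w.fold (fun (_ : Nat) i _ ↦ i) 0
      let b := C.blockOf.getD someIdx 0
      if b / 4096 ≤ 8 then
        byBlock := byBlock.insert b ((byBlock.getD b #[]).push w)
  let mut perDeg : Array (Nat × Nat × Nat) := Array.replicate 9 (0, 0, 0)
  for (b, m) in C.blockSize.toList do
    let d := b / 4096
    if d ≤ 8 then
      let vecs := byBlock.getD b #[]
      let (_, _, _, good) := blockVerdict C m vecs
      let (dim, nb, ng) := perDeg[d]!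
      perDeg := perDeg.set! d (dim + m, nb + 1, ng + (if good then 1 else 0))
  return (words10d8.size, ok, same, perDeg.toList)

/-- **ALL-`n` window-closure certificate, degrees `≤ 8`:** the symbolic replay of the 8 069 words succeeds, agrees
at `n = 10` with the numeric replay of `WindowCertificate10`, and in EVERY (degree `d ≤ 8`, weight) block of the
stable basis (`165` blocks; dimensions `1, 4, 13, 40, 111, 284, 687, 1592, 3550` per degree) the `F_p[n]`-module
spanned by the polynomial word vectors is the whole block: so for every `n ≥ 10` the words span `H^{≤8}(A^[n])`
modulo `p`, hence over `ℚ`. [cite: LiQinWang2002W, Thm 4.6 (𝔊_k for K, e numerically trivial)] -/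
theorem allN10_d8 : certAllN10d8 =
    (8069, true, true, [(1, 1, 1), (4, 4, 4), (13, 5, 5), (40, 12, 12), (111, 13, 13), (284, 24, 24), (687, 25, 25),
      (1592, 40, 40), (3550, 41, 41)]) := by
  native_decide

end Literature.Computation.AbelianHilbFock
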